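import Summits.NavierStokesRegularity.NavierStokesRegularity.Theorems.TaoLadderRungTwoFlatHopTubeLanding
import HarnessLib

/-!
# Tao ladder, rung two (flat lattice) — hop-tube frame: the TWO-PIECE tube weight (cell theory-1 g41, A52-3 / R52-2)

PROVENANCE (p1 g22): theory-1 g41's image of record numT53/TubeWeightTwoPiece53.lean sha16 61e235d671b15072 (farm `lean check` rc 0 · 0 sorry · 0 warnings),
landed with declarations BYTE-IDENTICAL + four lint docstring cite keys (`[cite: cell …]` → a bib key / `folklore` first) (helper for the K_A♭ parent item stmt-NavierStokesRegularity-22987); the image's module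
docstring follows verbatim.

MODEL-lattice bookkeeping only (Tao's dyadic cascade ODE restricted to a flat table); nothing here is about the
Navier–Stokes equations and nothing is certified numerically.

The landed one-piece Gaussian `tubeWeight C b` (`HopTubeLanding`) grows from shell `0` on.  The cell's design
constraint (K6)/TRAP #7 (LADDER §52.5, §52.7, design note D6) asks that the tail weight be FLAT up to an
`ε₀`-dependent interface shell `k_A(ε₀)` (so the Ahead clause `4·w_k·|z_k| ≤ r(ε₀)` is compatible with the Core
deviations pumped one shell forward per hop) and grow doubling-fast only from `k_A` on.  Since `w` is `∃`-quantified
per `ε₀` in the route's child, this costs nothing at route level; this file supplies the weight and its four format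
checks in TRANSPORTED form, reusing the landed Gaussian API:

* `tubeWeight₂ C b kA k := tubeWeight C (b + kA) (k − kA)` — equal to `C` for `k ≤ kA`, Gaussian from `kA` on
  (linear coefficient `b + kA`, which is what makes the growth condition `2(1+ε₀)^k w_k ≤ w_{k+1}` hold from `kA` on);
* `one_le_tubeWeight₂`, `tubeWeight₂_behind` (`w_k ≤ C(1+ε₀)^{−k}` for `k ≤ 0`), `tubeWeight₂_grow` (from `kA` on),
  `tubeWeight₂_tailThin` (transport of `tubeWeight_tailThin` with `r ↦ r(1+ε₀)^{5kA/2}`);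
* `tubeEnv₂` + `tubeStatics_tubeWeight₂` — `TubeStatics` for the two-piece weight from schedule sups alone, exactly as
  `tubeStatics_tubeWeight`, under the interface condition `kA ≤ k₁`;
* `exists_interface_shell` — the interface inequality `M·(g⁸)⁻¹^n ≤ r` ((★★) of LADDER §52.7 with `M = 8C₈C δ̄⁸`,
  `n = k_A − 1`) is solvable for every `r > 0` (the one-piece Gaussian has a positive `r_min` instead).

[cite: Tao2016AveragedNS, §6.2 Prop. 6.3 (ix) (weighted tail clause, statement shape); cell LADDER §52.5/§52.7 (R52-2), §53]
-/

set_option linter.dupNamespace false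

namespace Summit.NavierStokesRegularity.NavierStokesRegularity.Theorems.HopTube

open Literature.Analysis.FluidPDE Literature.Analysis.FluidPDE.TaoCascade

noncomputable section

section TwoPieceWeight

/-- The TWO-PIECE tube weight of R52-2 in transported form: the landed Gaussian with linear coefficient `b + kA`,
shifted to start at the interface shell `kA`.  [cite: Tao2016AveragedNS, §6.2 Prop. 6.3 (ix); cell LADDER §52.5 (R52-2)] -/
def tubeWeight₂ (C b : ℝ) (kA : ℕ) (k : ℤ) : ℝ := tubeWeight C (b + kA) (k - kA)

/-- Below the interface the weight is flat: `w_k = C` for `k < kA`. [folklore; cell LADDER §52.5 (R52-2)] -/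
theorem tubeWeight₂_of_lt (C b : ℝ) {kA : ℕ} {k : ℤ} (hk : k < kA) : tubeWeight₂ C b kA k = C :=
  tubeWeight_of_neg C (b + kA) (by omega)

/-- From the interface on the weight is the shifted Gaussian. [folklore; cell LADDER §52.5 (R52-2)] -/
theorem tubeWeight₂_of_le (C b : ℝ) {kA : ℕ} {k : ℤ} (hk : (kA : ℤ) ≤ k) :
    tubeWeight₂ C b kA k = C * (2 : ℝ) ^ (((k : ℝ) - kA) ^ 2 / 2 + (b + kA) * ((k : ℝ) - kA)) := by
  unfold tubeWeight₂
  rw [tubeWeight_of_nonneg C (b + kA) (by omega : 0 ≤ k - kA)]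
  push_cast; ring_nf

/-- At the interface shell itself the weight is still `C` (so it is flat on `k ≤ kA`). [folklore; cell LADDER §52.5 (R52-2)] -/
theorem tubeWeight₂_self (C b : ℝ) (kA : ℕ) : tubeWeight₂ C b kA kA = C := by
  rw [tubeWeight₂_of_le C b le_rfl]; simp

/-- Weights are `≥ 1` (`C ≥ 1`, `b ≥ 0`). [folklore] -/
theorem one_le_tubeWeight₂ {C b : ℝ} (hC : 1 ≤ C) (hb : 0 ≤ b) (kA : ℕ) (k : ℤ) : 1 ≤ tubeWeight₂ C b kA k :=
  one_le_tubeWeight hC (by positivity) (k - kA)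

/-- TAME BEHIND: `w_k ≤ C(1+ε₀)^{−k}` for `k ≤ 0` (the weight is the constant `C` there). [folklore] -/
theorem tubeWeight₂_behind {C b ε₀ : ℝ} (hC : 0 ≤ C) (hε : 0 ≤ ε₀) (kA : ℕ) (k : ℤ) (hk : k ≤ 0) :
    tubeWeight₂ C b kA k ≤ C * (1 + ε₀) ^ (-(k : ℝ)) := by
  have hpow : 1 ≤ (1 + ε₀) ^ (-(k : ℝ)) :=
    Real.one_le_rpow (by linarith) (by have h' : (k : ℝ) ≤ 0 := (by exact_mod_cast hk); linarith)
  have hwk : tubeWeight₂ C b kA k = C := by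
    rcases lt_or_ge k (kA : ℤ) with h | h
    · exact tubeWeight₂_of_lt C b h
    · have h0 : k = (kA : ℤ) := le_antisymm (by omega) h
      rw [h0]; exact tubeWeight₂_self C b kA
  rw [hwk]
  exact le_mul_of_one_le_right hC hpow

/-- DOUBLING-FAST GROWTH from the interface on: `2(1+ε₀)^k w_k ≤ w_{k+1}` for `k ≥ kA` (`0 ≤ ε₀ ≤ 1`, `b ≥ 1/2`;
the shift of the linear coefficient by `kA` is exactly what absorbs the factor `(1+ε₀)^{kA}`). [folklore] -/
theorem tubeWeight₂_grow {C b ε₀ : ℝ} (hε : 0 ≤ ε₀) (hε1 : ε₀ ≤ 1) (hC : 0 < C) (hb : 1 / 2 ≤ b)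
    (kA : ℕ) (k : ℤ) (hk : (kA : ℤ) ≤ k) :
    2 * (1 + ε₀) ^ (k : ℝ) * tubeWeight₂ C b kA k ≤ tubeWeight₂ C b kA (k + 1) := by
  have h2 : (0 : ℝ) < 2 := by norm_num
  have hk0 : (0 : ℝ) ≤ k := by exact_mod_cast (le_trans (Int.natCast_nonneg kA) hk)
  rw [tubeWeight₂_of_le C b hk, tubeWeight₂_of_le C b (by omega : (kA : ℤ) ≤ k + 1)]
  set E : ℝ := ((k : ℝ) - kA) ^ 2 / 2 + (b + kA) * ((k : ℝ) - kA) with hE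
  have hsplit : (((k + 1 : ℤ) : ℝ) - kA) ^ 2 / 2 + (b + kA) * (((k + 1 : ℤ) : ℝ) - kA) = E + ((k : ℝ) + b + 1 / 2) := by
    rw [hE]; push_cast; ring
  have hR : (2 : ℝ) ^ (E + ((k : ℝ) + b + 1 / 2)) = (2 : ℝ) ^ E * (2 : ℝ) ^ ((k : ℝ) + b + 1 / 2) :=
    Real.rpow_add h2 _ _
  rw [hsplit, hR]
  have hEpos : 0 < (2 : ℝ) ^ E := Real.rpow_pos_of_pos h2 E
  -- reduce to `2 (1+ε₀)^k ≤ 2^{k + b + 1/2}`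
  have hbase : (1 + ε₀) ^ (k : ℝ) ≤ (2 : ℝ) ^ (k : ℝ) :=
    Real.rpow_le_rpow (by linarith) (by linarith) hk0
  have hexp : (2 : ℝ) ^ ((k : ℝ) + 1) ≤ (2 : ℝ) ^ ((k : ℝ) + b + 1 / 2) :=
    Real.rpow_le_rpow_of_exponent_le (by norm_num) (by linarith)
  have hstep : 2 * (1 + ε₀) ^ (k : ℝ) ≤ (2 : ℝ) ^ ((k : ℝ) + b + 1 / 2) := by
    calc 2 * (1 + ε₀) ^ (k : ℝ) ≤ 2 * (2 : ℝ) ^ (k : ℝ) := by linarith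
      _ = (2 : ℝ) ^ ((k : ℝ) + 1) := by rw [Real.rpow_add h2, Real.rpow_one]; ring
      _ ≤ (2 : ℝ) ^ ((k : ℝ) + b + 1 / 2) := hexp
  calc 2 * (1 + ε₀) ^ (k : ℝ) * (C * (2 : ℝ) ^ E)
      = (C * (2 : ℝ) ^ E) * (2 * (1 + ε₀) ^ (k : ℝ)) := by ring
    _ ≤ (C * (2 : ℝ) ^ E) * (2 : ℝ) ^ ((k : ℝ) + b + 1 / 2) :=
        mul_le_mul_of_nonneg_left hstep (by positivity)
    _ = C * ((2 : ℝ) ^ E * (2 : ℝ) ^ ((k : ℝ) + b + 1 / 2)) := by ring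

/-- THIN TAIL for the two-piece weight: transport of `tubeWeight_tailThin` (kick size `r ↦ r·(1+ε₀)^{5kA/2}`,
threshold shifted by `kA`). [folklore] -/
theorem tubeWeight₂_tailThin {C b ε₀ r : ℝ} (hε : 0 ≤ ε₀) (hε1 : ε₀ ≤ 1) (hr : 0 ≤ r) (hC : 0 < C) (kA : ℕ) :
    TailThin ε₀ (tubeWeight₂ C b kA) r := by
  intro ϑ hϑ
  have hpos : (0 : ℝ) < 1 + ε₀ := by linarith
  have hr' : 0 ≤ r * (1 + ε₀) ^ ((5 : ℝ) * kA / 2) := mul_nonneg hr (Real.rpow_pos_of_pos hpos _).le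
  obtain ⟨k₂, hk₂⟩ := tubeWeight_tailThin (b := b + kA) hε hε1 hr' hC ϑ hϑ
  refine ⟨k₂ + kA, fun k hk => ?_⟩
  have h := hk₂ (k - kA) (by omega)
  have e1 : tubeWeight C (b + kA) (k - kA + 1) = tubeWeight₂ C b kA (k + 1) := by
    unfold tubeWeight₂; congr 1; ring
  have e0 : tubeWeight C (b + kA) (k - kA) = tubeWeight₂ C b kA k := rfl
  have hexp : (1 + ε₀) ^ ((5 : ℝ) * (k + 2) / 2)
      = (1 + ε₀) ^ ((5 : ℝ) * (((k - kA : ℤ) : ℝ) + 2) / 2) * (1 + ε₀) ^ ((5 : ℝ) * kA / 2) := by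
    rw [← Real.rpow_add hpos]; congr 1; push_cast; ring
  rw [e1, e0] at h
  calc (1 + ε₀) ^ ((5 : ℝ) * (k + 2) / 2) * r * tubeWeight₂ C b kA (k + 1)
      = (1 + ε₀) ^ ((5 : ℝ) * (((k - kA : ℤ) : ℝ) + 2) / 2) * (r * (1 + ε₀) ^ ((5 : ℝ) * kA / 2))
          * tubeWeight₂ C b kA (k + 1) := by rw [hexp]; ring
    _ ≤ ϑ * tubeWeight₂ C b kA k ^ 2 := h

/-- The TUBE ENVELOPE for the two-piece weight (same shape as `tubeEnv`). [cite: Tao2016AveragedNS, §6.2 Prop. 6.3 (ix); cell LADDER §50.9] -/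
def tubeEnv₂ (P : TubeSchedule) (ε₀ K₀ r C b : ℝ) (kA : ℕ) (Eb : ℝ) : ℤ → ℝ := fun k =>
  if (P.k₁ : ℤ) ≤ k then K₀ * r ^ 2 / tubeWeight₂ C b kA (k - 1) ^ 2 else Eb * (1 + ε₀) ^ (2 * P.θb * |(k : ℝ)|)

/-- From the tail shell on, the envelope is `K₀r²/w(k−1)²`. [cite: Tao2016AveragedNS, §6.2 Prop. 6.3 (ix); cell LADDER §50.9] -/
theorem tubeEnv₂_of_le (P : TubeSchedule) (ε₀ K₀ r C b : ℝ) (kA : ℕ) (Eb : ℝ) {k : ℤ} (hk : (P.k₁ : ℤ) ≤ k) :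
    tubeEnv₂ P ε₀ K₀ r C b kA Eb k = K₀ * r ^ 2 / tubeWeight₂ C b kA (k - 1) ^ 2 := by
  simp [tubeEnv₂, hk]

/-- **STATICS WITH THE TWO-PIECE WEIGHT**: as `tubeStatics_tubeWeight`, for `w := tubeWeight₂ C b kA` and
`env₀ := tubeEnv₂ …`, under the interface condition `kA ≤ k₁` (of record `k₁ = k_A(ε₀)`).
[cite: Tao2016AveragedNS, §6.2 Prop. 6.3 (ix), §6.3–6.4; cell LADDER §50, §52.5 (R52-2)] -/
theorem tubeStatics_tubeWeight₂ (P : TubeSchedule) {ε₀ : ℝ} {i₀ : Fin 2} {X₀ : Fin 2 → ℝ} {r : ℝ}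
    {ζ : ℕ → Fin 2 → ℤ → ℝ} {ustar : Fin 2 → ℤ → ℝ} {σ θ₀ θ c₀ c C b K₀ Eb C₄ : ℝ} {kA : ℕ}
    (hε : 0 ≤ ε₀) (hε1 : ε₀ ≤ 1) (hC : 1 ≤ C) (hbw : 1 / 2 ≤ b) (hkA : kA ≤ P.k₁)
    (hr : 0 < r) (hθ0 : 0 ≤ θ₀) (hθ : θ₀ < θ) (hθh : θ ≤ 1 / 2) (hc0 : 0 < c₀) (hc : c₀ < c) (hσ : 0 < σ)
    (hk₁ : 1 ≤ P.k₁)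
    (hC4 : ∀ k : ℤ, (P.k₁ : ℤ) ≤ k →
      (1 + ε₀) ^ ((5 : ℝ) * (k + 2) / 2) * r * tubeWeight₂ C b kA (k + 1) ≤ C₄ * tubeWeight₂ C b kA k ^ 2)
    (hg : 1 ≤ P.g) (hb : 1 ≤ P.b) (hAstar : 0 < P.Astar) (hθb1 : P.θb ≤ 1)
    {Abar δbar ηbar Mζ Mu : ℝ} (hA : ∀ n, 0 ≤ P.A n ∧ P.A n ≤ Abar) (hδ : ∀ n, P.δ n ≤ δbar) (hδ0 : 0 ≤ δbar)
    (hη : ∀ n, P.η n ≤ ηbar) (hη0 : 0 ≤ ηbar) (hζ : ∀ n i k, |ζ n i k| ≤ Mζ)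
    (hu : ∀ i k, -(P.K : ℤ) ≤ k → |ustar i k| ≤ Mu) (hMu : 0 ≤ Mu) :
    TubeStatics P σ ε₀ i₀ X₀ (tubeWeight₂ C b kA) r θ₀ c₀ (tubeEnv₂ P ε₀ K₀ r C b kA Eb) ζ ustar θ c := by
  have hC0 : 0 < C := by linarith
  refine tubeStatics_of_schedule (K₀ := K₀) (Cw := C) P hr hθ0 hθ hθh hc0 hc hσ
    (one_le_tubeWeight₂ hC (by linarith) kA) hk₁ ?_ ?_ hC4 ?_
    hg hb hAstar hε hθb1 hA hδ hδ0 hη hη0 hζ hu hMu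
  · intro k hk
    exact tubeWeight₂_grow hε hε1 hC0 hbw kA k (le_trans (by exact_mod_cast hkA) hk)
  · intro k hk; exact (tubeEnv₂_of_le P ε₀ K₀ r C b kA Eb hk).le
  · intro k hk
    exact tubeWeight₂_behind hC0.le hε kA k hk

/-- INTERFACE SOLVABILITY ((★★) of LADDER §52.7 with `M = 8C₈Cδ̄⁸`, `q = g⁻⁸`, `n = k_A − 1`): for every kick size
`r > 0` some interface depth makes the pumped Core deviation Ahead-legal, `M·qⁿ ≤ r` — because below the interface
the two-piece weight is the constant `C` (for the one-piece Gaussian the analogous quantity has a positive minimum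
over `n`, LADDER §52.7's `r_min`). [folklore; cell LADDER §52.7] -/
theorem exists_interface_shell {M q r : ℝ} (hM : 0 ≤ M) (hq0 : 0 ≤ q) (hq : q < 1) (hr : 0 < r) :
    ∃ n : ℕ, M * q ^ n ≤ r := by
  obtain ⟨n, hn⟩ := exists_pow_lt_of_lt_one (div_pos hr (by linarith : (0 : ℝ) < M + 1)) hq
  refine ⟨n, ?_⟩
  have hqn : 0 ≤ q ^ n := pow_nonneg hq0 n
  have h1 : M * q ^ n ≤ (M + 1) * q ^ n := mul_le_mul_of_nonneg_right (by linarith) hqn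
  have h2 : (M + 1) * q ^ n ≤ (M + 1) * (r / (M + 1)) := mul_le_mul_of_nonneg_left hn.le (by linarith)
  have h3 : (M + 1) * (r / (M + 1)) = r := by field_simp
  linarith

end TwoPieceWeight

end

end Summit.NavierStokesRegularity.NavierStokesRegularity.Theorems.HopTube
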